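import Summits.KontsevichZagierPeriods.Zeta5Search.Certificates.RecordRayDenominatorsAtlas33CellsB
import HarnessLib

/-!
# ζ(5) search — the record ray's DENOMINATORS, X-d: the 33-window atlas and the hypothesis-free exponent `0.5823` (p3 g5)

HONEST FRAMING: systematic search; no irrationality claim unless certified.

OUR work (Summit side; prover seat p3, generation 5).  The 27-window atlas of file X-b (typer g15, `record_exponent_atlas27`,
`γ ≤ 0.5799`) refined by the census g27 "three free steps" (file X-c: seven more windows from the PROVED A4/L5 windows
`θ ≤ 9/8` and the raised exponents on `(41/10, 25/6]`, `(41/5, 25/3]` from `RecWindowM14/M8` + their proved boundary layers):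
`Φ_n = ∏_i (∏_{A_i n < p ≤ B_i n} p)^{k_i}` over 33 windows (tables `AZv/BZv/wQv`, units `1/79560`), `MV n = M0 n / Φ_n`:
`MV·P_n ∈ ℤ`, `MV·Q(a·n) ∈ ℤ` (`multiWindowProd_dvd_int`, window by window, `n ≥ 47`), `Φ_n ≥ e^{(21192947 / 79560 − ε)n}` by the prime
number theorem (`Σ k_i(B_i − A_i) = 21192947 / 79560 = 266.3769`; atlas27 `265.5468`), so `MV n ≤ e^{(115.1463 + ε)n}` and

* `record_exponent_atlas33` — **hypothesis-free: for every `0 ≤ γ ≤ 0.5823`, eventually `|ζ(5) − P_n/Q(a·n)| < 1/q_n^γ`** with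
  the integers `p_n = MV n·P_n`, `q_n = MV n·|Q(a·n)|` (ladder: `0.2499` → `0.4949` → `0.536` → `0.5525` → `0.5799` (X-b) → `0.5823`;
  Brown–Zudilin print `0.86` from the observed laws (28)–(30); census KERNEL-LEDGER model of this step `0.5823`).

No irrationality content (`γ < 1`).
-/

noncomputable section

open Finset Real Filter Topology

namespace Summit.KontsevichZagierPeriods.Zeta5Search.RecordRay

open Summit.KontsevichZagierPeriods.Zeta5Search.DualSeries
open Summit.KontsevichZagierPeriods.Zeta5Search.DualSeriesDenominators
open Summit.KontsevichZagierPeriods.Zeta5Search.WedgeDictionary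
open Summit.KontsevichZagierPeriods.Zeta5Search.DualSeriesLemma19 (bRecord)
open Literature.NumberTheory.Irrationality.Hata1992
open Literature.NumberTheory.Transcendental (zetaValue)

/-- The windows are genuine intervals (integer table, by evaluation). -/
theorem AZv_le_BZv : ∀ i : Fin 33, AZv i ≤ BZv i := by decide

/-- The windows are pairwise separated (integer table, by evaluation). -/
theorem windowsV_separated : ∀ i j : Fin 33, i ≠ j → BZv i ≤ AZv j ∨ BZv j ≤ AZv i := by decide

/-- `Σ_i k_i (BZ_i − AZ_i) = 21192947` (`= 79560 · 21192947 / 79560`; integer table, by evaluation). -/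
theorem window_rateZv : ∑ i : Fin 33, wQv i * (BZv i - AZv i) = 21192947 := by decide

/-- The window factor `Φ_n`. -/
def corrV (n : ℕ) : ℕ := multiWindowProd Finset.univ AwinV BwinV wQv n

/-- **The multiplier** `MV n = M0 n / Φ_n`. -/
def MV (n : ℕ) : ℚ := M0 n / (corrV n : ℚ)

/-- `Φ_n > 0`. -/
theorem corrV_pos (n : ℕ) : 0 < corrV n := multiWindowProd_pos _ _ _ _ _

/-- `0 < MV n`. -/
theorem MV_pos (n : ℕ) : 0 < MV n := div_pos (M0_pos n) (by exact_mod_cast corrV_pos n)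

/-- `0 ≤ A_i ≤ B_i` over `ℝ`. -/
theorem AwinV_le_BwinV : ∀ i ∈ (Finset.univ : Finset (Fin 33)), 0 ≤ AwinV i ∧ AwinV i ≤ BwinV i := by
  intro i _
  have h : (AZv i : ℝ) ≤ BZv i := by exact_mod_cast AZv_le_BZv i
  refine ⟨by unfold AwinV; positivity, ?_⟩
  unfold AwinV BwinV
  exact div_le_div_of_nonneg_right h (by norm_num)

/-- `Σ_i k_i (B_i − A_i) = 21192947 / 79560` over `ℝ`. -/
theorem window_rateV : ∑ i ∈ (Finset.univ : Finset (Fin 33)), (wQv i : ℝ) * (BwinV i - AwinV i) = 21192947 / 79560 := by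
  have h : ∀ i : Fin 33, (wQv i : ℝ) * (BwinV i - AwinV i) = ((wQv i * (BZv i - AZv i) : ℕ) : ℝ) / 79560 := by
    intro i
    have hle := AZv_le_BZv i
    unfold AwinV BwinV
    push_cast [Nat.cast_sub hle]
    ring
  rw [Finset.sum_congr rfl fun i _ => h i, ← Finset.sum_div]
  have hz : ((∑ i : Fin 33, wQv i * (BZv i - AZv i) : ℕ) : ℝ) = 21192947 := by exact_mod_cast window_rateZv
  rw [← Nat.cast_sum, hz]

/-- A prime of window `i`: prime, `A_i n < p ≤ B_i n`. -/
theorem windowV_prime {n : ℕ} {i : Fin 33} {p : ℕ} (hp : p ∈ windowPrimes (AwinV i) (BwinV i) n) :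
    p.Prime ∧ AwinV i * n < p ∧ (p : ℝ) ≤ BwinV i * n :=
  (mem_windowPrimes_iff (AwinV_le_BwinV i (Finset.mem_univ _)).1).1 hp

/-- The windows are pairwise disjoint. -/
theorem windowsV_disjoint (n : ℕ) : ∀ i ∈ (Finset.univ : Finset (Fin 33)), ∀ j ∈ (Finset.univ : Finset (Fin 33)), i ≠ j →
    Disjoint (windowPrimes (AwinV i) (BwinV i) n) (windowPrimes (AwinV j) (BwinV j) n) := by
  intro i _ j _ hij
  rw [Finset.disjoint_left]
  intro p hpi hpj
  obtain ⟨-, a1, b1⟩ := windowV_prime hpi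
  obtain ⟨-, a2, b2⟩ := windowV_prime hpj
  have hn : (0 : ℝ) ≤ n := Nat.cast_nonneg n
  rcases windowsV_separated i j hij with h | h
  · have h' : BwinV i ≤ AwinV j := by
      unfold AwinV BwinV; exact div_le_div_of_nonneg_right (by exact_mod_cast h) (by norm_num)
    nlinarith [mul_le_mul_of_nonneg_right h' hn]
  · have h' : BwinV j ≤ AwinV i := by
      unfold AwinV BwinV; exact div_le_div_of_nonneg_right (by exact_mod_cast h) (by norm_num)
    nlinarith [mul_le_mul_of_nonneg_right h' hn]

/-- An old window of files VI-a/b/c: the same endpoints (`× 17`) in the 20-window tables. -/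
theorem win_convW {i : Fin 33} {j : Fin 20} (hA : AZv i = 17 * AZw j) (hB : BZv i = 17 * BZw j) {n p : ℕ}
    (h1 : AwinV i * n < p) (h2 : (p : ℝ) ≤ BwinV i * n) : AwinW j * n < p ∧ (p : ℝ) ≤ BwinW j * n := by
  unfold AwinV at h1; unfold BwinV at h2
  unfold AwinW BwinW
  rw [hA] at h1; rw [hB] at h2
  push_cast at h1 h2
  constructor
  · have e : ((17 : ℝ) * (AZw j : ℝ)) / 79560 = (AZw j : ℝ) / 4680 := by ring
    rw [← e]; exact h1
  · have e : ((17 : ℝ) * (BZw j : ℝ)) / 79560 = (BZw j : ℝ) / 4680 := by ring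
    rw [← e]; exact h2

/-- An old window of file X-a: the same endpoints (`× 17`) in the 27-window tables. -/
theorem win_convY {i : Fin 33} {j : Fin 27} (hA : AZv i = 17 * AZy j) (hB : BZv i = 17 * BZy j) {n p : ℕ}
    (h1 : AwinV i * n < p) (h2 : (p : ℝ) ≤ BwinV i * n) : AwinY j * n < p ∧ (p : ℝ) ≤ BwinY j * n := by
  unfold AwinV at h1; unfold BwinV at h2
  unfold AwinY BwinY
  rw [hA] at h1; rw [hB] at h2
  push_cast at h1 h2
  constructor
  · have e : ((17 : ℝ) * (AZy j : ℝ)) / 79560 = (AZy j : ℝ) / 4680 := by ring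
    rw [← e]; exact h1
  · have e : ((17 : ℝ) * (BZy j : ℝ)) / 79560 = (BZy j : ℝ) / 4680 := by ring
    rw [← e]; exact h2

/-- Integer form of the left inequality of a window (`A = AZv i` by evaluation at the call site). -/
theorem lo_nat {i : Fin 33} {A n p : ℕ} (hA : AZv i = A) (h1 : AwinV i * n < p) : A * n < 79560 * p := by
  unfold AwinV at h1
  rw [hA, div_mul_eq_mul_div, div_lt_iff₀ (by norm_num : (0 : ℝ) < 79560)] at h1
  have h : (A : ℝ) * n < 79560 * p := by linarith
  exact_mod_cast h

/-- Integer form of the right inequality of a window (`B = BZv i` by evaluation at the call site). -/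
theorem hi_nat {i : Fin 33} {B n p : ℕ} (hB : BZv i = B) (h2 : (p : ℝ) ≤ BwinV i * n) : 79560 * p ≤ B * n := by
  unfold BwinV at h2
  rw [hB, div_mul_eq_mul_div, le_div_iff₀ (by norm_num : (0 : ℝ) < 79560)] at h2
  have h : (79560 : ℝ) * p ≤ (B : ℝ) * n := by linarith
  exact_mod_cast h

/-- **The window divisibilities** (`n ≥ 47`): for every window `i` and every prime `p` in it, `p^{k_i}` divides the multiplied
wedge and the multiplied Q-minor. -/
theorem windowsV_dvd {n : ℕ} (hn : 47 ≤ n)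
    {zW zV zW' zV' zU zU' : ℤ}
    (hzW : dRec n ^ 3 * sharpNormaliser (bRecord n) * coeffW (bRecord n) = zW)
    (hzV : dRec n ^ 6 * sharpNormaliser (bRecord n) * coeffV (bRecord n) = zV)
    (hzW' : dRec n ^ 3 * sharpNormaliser (bRecord' n) * coeffW (bRecord' n) = zW')
    (hzV' : dRec n ^ 6 * sharpNormaliser (bRecord' n) * coeffV (bRecord' n) = zV')
    (hzU : dRec n * sharpNormaliser (bRecord n) * coeffU (bRecord n) = zU)
    (hzU' : dRec n * sharpNormaliser (bRecord' n) * coeffU (bRecord' n) = zU') :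
    ∀ i ∈ (Finset.univ : Finset (Fin 33)), ∀ p ∈ windowPrimes (AwinV i) (BwinV i) n,
      ((p : ℤ) ^ wQv i ∣ (zW' * zV - zW * zV')) ∧
      ((p : ℤ) ^ wQv i ∣ ((Nat.lcmUpto (41 * n) : ℤ) ^ 5 * (zU * zW') - (Nat.lcmUpto (41 * n) : ℤ) ^ 5 * (zU' * zW))) := by
  have hn42 : 42 ≤ n := by omega
  intro i _ p hp
  obtain ⟨hpr, h1, h2⟩ := windowV_prime hp
  fin_cases i
  · obtain ⟨h1', h2'⟩ := win_convW (i := 0) (j := 0) (by decide) (by decide) h1 h2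
    exact wBig0 hn42 hpr h1' h2' hzW hzV hzW' hzV' hzU hzU'
  · obtain ⟨h1', h2'⟩ := win_convW (i := 1) (j := 1) (by decide) (by decide) h1 h2
    exact wBig1 hn42 hpr h1' h2' hzW hzV hzW' hzV' hzU hzU'
  · obtain ⟨h1', h2'⟩ := win_convW (i := 2) (j := 2) (by decide) (by decide) h1 h2
    exact wBig2 hn42 hpr h1' h2' hzW hzV hzW' hzV' hzU hzU'
  · obtain ⟨h1', h2'⟩ := win_convW (i := 3) (j := 3) (by decide) (by decide) h1 h2
    exact wBig3 hn42 hpr h1' h2' hzW hzV hzW' hzV' hzU hzU'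
  · obtain ⟨h1', h2'⟩ := win_convW (i := 4) (j := 4) (by decide) (by decide) h1 h2
    exact wCell0 hn42 hpr h1' h2' hzW hzV hzW' hzV' hzU hzU'
  · obtain ⟨h1', h2'⟩ := win_convW (i := 5) (j := 5) (by decide) (by decide) h1 h2
    exact wCell1 hn42 hpr h1' h2' hzW hzV hzW' hzV' hzU hzU'
  · obtain ⟨h1', h2'⟩ := win_convW (i := 6) (j := 6) (by decide) (by decide) h1 h2
    exact wCell2 hn42 hpr h1' h2' hzW hzV hzW' hzV' hzU hzU'
  · obtain ⟨h1', h2'⟩ := win_convW (i := 7) (j := 7) (by decide) (by decide) h1 h2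
    exact wCell3 hn42 hpr h1' h2' hzW hzV hzW' hzV' hzU hzU'
  · exact wFree6 hn hpr (lo_nat (i := 8) (by decide) h1) (hi_nat (i := 8) (by decide) h2) hzW hzV hzW' hzV' hzU hzU'
  · obtain ⟨h1', h2'⟩ := win_convW (i := 9) (j := 9) (by decide) (by decide) h1 h2
    exact wCell5 hn42 hpr h1' h2' hzW hzV hzW' hzV' hzU hzU'
  · obtain ⟨h1', h2'⟩ := win_convW (i := 10) (j := 10) (by decide) (by decide) h1 h2
    exact wCell6 hn42 hpr h1' h2' hzW hzV hzW' hzV' hzU hzU'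
  · obtain ⟨h1', h2'⟩ := win_convW (i := 11) (j := 11) (by decide) (by decide) h1 h2
    exact wCell7 hn42 hpr h1' h2' hzW hzV hzW' hzV' hzU hzU'
  · obtain ⟨h1', h2'⟩ := win_convW (i := 12) (j := 12) (by decide) (by decide) h1 h2
    exact wCell8 hn42 hpr h1' h2' hzW hzV hzW' hzV' hzU hzU'
  · obtain ⟨h1', h2'⟩ := win_convW (i := 13) (j := 13) (by decide) (by decide) h1 h2
    exact wCell9 hn42 hpr h1' h2' hzW hzV hzW' hzV' hzU hzU'
  · obtain ⟨h1', h2'⟩ := win_convW (i := 14) (j := 14) (by decide) (by decide) h1 h2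
    exact wCell10 hn42 hpr h1' h2' hzW hzV hzW' hzV' hzU hzU'
  · obtain ⟨h1', h2'⟩ := win_convW (i := 15) (j := 15) (by decide) (by decide) h1 h2
    exact wCell11 hn42 hpr h1' h2' hzW hzV hzW' hzV' hzU hzU'
  · obtain ⟨h1', h2'⟩ := win_convW (i := 16) (j := 16) (by decide) (by decide) h1 h2
    exact wCell12 hn42 hpr h1' h2' hzW hzV hzW' hzV' hzU hzU'
  · obtain ⟨h1', h2'⟩ := win_convW (i := 17) (j := 17) (by decide) (by decide) h1 h2
    exact wCell13 hn42 hpr h1' h2' hzW hzV hzW' hzV' hzU hzU'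
  · exact wFree7 hn hpr (lo_nat (i := 18) (by decide) h1) (hi_nat (i := 18) (by decide) h2) hzW hzV hzW' hzV' hzU hzU'
  · obtain ⟨h1', h2'⟩ := win_convW (i := 19) (j := 19) (by decide) (by decide) h1 h2
    exact wCell15 hn42 hpr h1' h2' hzW hzV hzW' hzV' hzU hzU'
  · obtain ⟨h1', h2'⟩ := win_convY (i := 20) (j := 20) (by decide) (by decide) h1 h2
    exact wCellY0 hn42 hpr h1' h2' hzW hzV hzW' hzV' hzU hzU'
  · obtain ⟨h1', h2'⟩ := win_convY (i := 21) (j := 21) (by decide) (by decide) h1 h2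
    exact wCellY1 hn42 hpr h1' h2' hzW hzV hzW' hzV' hzU hzU'
  · obtain ⟨h1', h2'⟩ := win_convY (i := 22) (j := 22) (by decide) (by decide) h1 h2
    exact wCellY2 hn42 hpr h1' h2' hzW hzV hzW' hzV' hzU hzU'
  · obtain ⟨h1', h2'⟩ := win_convY (i := 23) (j := 23) (by decide) (by decide) h1 h2
    exact wCellY3 hn42 hpr h1' h2' hzW hzV hzW' hzV' hzU hzU'
  · obtain ⟨h1', h2'⟩ := win_convY (i := 24) (j := 24) (by decide) (by decide) h1 h2
    exact wLawY0 hn42 hpr h1' h2' hzW hzV hzW' hzV' hzU hzU'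
  · obtain ⟨h1', h2'⟩ := win_convY (i := 25) (j := 25) (by decide) (by decide) h1 h2
    exact wLawY1 hn42 hpr h1' h2' hzW hzV hzW' hzV' hzU hzU'
  · obtain ⟨h1', h2'⟩ := win_convY (i := 26) (j := 26) (by decide) (by decide) h1 h2
    exact wLawY2 hn42 hpr h1' h2' hzW hzV hzW' hzV' hzU hzU'
  · exact wFree0 hn hpr (lo_nat (i := 27) (by decide) h1) (hi_nat (i := 27) (by decide) h2) hzW hzV hzW' hzV' hzU hzU'
  · exact wFree1 hn hpr (lo_nat (i := 28) (by decide) h1) (hi_nat (i := 28) (by decide) h2) hzW hzV hzW' hzV' hzU hzU'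
  · exact wFree2 hn hpr (lo_nat (i := 29) (by decide) h1) (hi_nat (i := 29) (by decide) h2) hzW hzV hzW' hzV' hzU hzU'
  · exact wFree3 hn hpr (lo_nat (i := 30) (by decide) h1) (hi_nat (i := 30) (by decide) h2) hzW hzV hzW' hzV' hzU hzU'
  · exact wFree4 hn hpr (lo_nat (i := 31) (by decide) h1) (hi_nat (i := 31) (by decide) h2) hzW hzV hzW' hzV' hzU hzU'
  · exact wFree5 hn hpr (lo_nat (i := 32) (by decide) h1) (hi_nat (i := 32) (by decide) h2) hzW hzV hzW' hzV' hzU hzU'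

/-- **`MV n · P_n ∈ ℤ`** (`n ≥ 47`). -/
theorem MV_mul_recordP_int {n : ℕ} (hn : 47 ≤ n) : ∃ z : ℤ, MV n * recordP n = z := by
  classical
  have hn1 : 1 ≤ n := by omega
  obtain ⟨⟨zU, hzU⟩, ⟨zW, hzW⟩, ⟨zV, hzV⟩, ⟨zU', hzU'⟩, ⟨zW', hzW'⟩, ⟨zV', hzV'⟩⟩ := sharp_ints hn1
  obtain ⟨s, -, hρ⟩ := exists_sign_mul_abs _ (rhoOf_aRec_ne_zero n)
  have habs : |rhoOf (aRec n)| ≠ 0 := abs_ne_zero.2 (rhoOf_aRec_ne_zero n)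
  have hdiv : rhoOf (aRec n) / |rhoOf (aRec n)| = s := by rw [div_eq_iff habs]; exact hρ
  have key : M0 n * recordP n = (rhoOf (aRec n) / |rhoOf (aRec n)|) *
      ((dRec n ^ 3 * sharpNormaliser (bRecord' n) * coeffW (bRecord' n)) *
      (dRec n ^ 6 * sharpNormaliser (bRecord n) * coeffV (bRecord n)) -
      (dRec n ^ 3 * sharpNormaliser (bRecord n) * coeffW (bRecord n)) *
      (dRec n ^ 6 * sharpNormaliser (bRecord' n) * coeffV (bRecord' n))) := by
    unfold M0 recordP
    field_simp
  rw [hdiv, hzW, hzV, hzW', hzV'] at key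
  have hdvd : ((corrV n : ℕ) : ℤ) ∣ (zW' * zV - zW * zV') := by
    apply multiWindowProd_dvd_int
    · intro i hi p hp
      exact ((windowsV_dvd hn hzW hzV hzW' hzV' hzU hzU') i hi p hp).1
    · exact windowsV_disjoint n
  obtain ⟨q, hq⟩ := hdvd
  refine ⟨s * q, ?_⟩
  have hc : (corrV n : ℚ) ≠ 0 := by exact_mod_cast (corrV_pos n).ne'
  have e : (zW' : ℚ) * zV - zW * zV' = (corrV n : ℚ) * q := by exact_mod_cast hq
  calc MV n * recordP n = M0 n * recordP n / corrV n := by unfold MV; ring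
    _ = s * ((zW' : ℚ) * zV - zW * zV') / corrV n := by rw [key]
    _ = ((s * q : ℤ) : ℚ) := by rw [e]; push_cast; field_simp

/-- **`MV n · Q(a·n) ∈ ℤ`** (`n ≥ 47`). -/
theorem MV_mul_recordQ_int {n : ℕ} (hn : 47 ≤ n) : ∃ z : ℤ, MV n * recordQ n = z := by
  classical
  have hn1 : 1 ≤ n := by omega
  obtain ⟨⟨zU, hzU⟩, ⟨zW, hzW⟩, ⟨zV, hzV⟩, ⟨zU', hzU'⟩, ⟨zW', hzW'⟩, ⟨zV', hzV'⟩⟩ := sharp_ints hn1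
  obtain ⟨s, -, hρ⟩ := exists_sign_mul_abs _ (rhoOf_aRec_ne_zero n)
  have habs : |rhoOf (aRec n)| ≠ 0 := abs_ne_zero.2 (rhoOf_aRec_ne_zero n)
  have hdiv : rhoOf (aRec n) / |rhoOf (aRec n)| = s := by rw [div_eq_iff habs]; exact hρ
  have hQ := recordQ_eq_wedge hn1
  have key : M0 n * recordQ n = (rhoOf (aRec n) / |rhoOf (aRec n)|) * dRec n ^ 5 *
      ((dRec n * sharpNormaliser (bRecord n) * coeffU (bRecord n)) *
      (dRec n ^ 3 * sharpNormaliser (bRecord' n) * coeffW (bRecord' n)) -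
      (dRec n * sharpNormaliser (bRecord' n) * coeffU (bRecord' n)) *
      (dRec n ^ 3 * sharpNormaliser (bRecord n) * coeffW (bRecord n))) := by
    unfold M0
    rw [hQ]
    field_simp
  rw [hdiv, hzU, hzW, hzU', hzW'] at key
  set D : ℤ := (Nat.lcmUpto (41 * n) : ℤ) with hD
  have hdvd : ((corrV n : ℕ) : ℤ) ∣ (D ^ 5 * (zU * zW') - D ^ 5 * (zU' * zW)) := by
    apply multiWindowProd_dvd_int
    · intro i hi p hp
      exact ((windowsV_dvd hn hzW hzV hzW' hzV' hzU hzU') i hi p hp).2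
    · exact windowsV_disjoint n
  obtain ⟨q, hq⟩ := hdvd
  refine ⟨s * q, ?_⟩
  have hc : (corrV n : ℚ) ≠ 0 := by exact_mod_cast (corrV_pos n).ne'
  have hDq : (D : ℚ) = dRec n := by rw [hD]; unfold dRec; push_cast; rfl
  have e : (dRec n) ^ 5 * ((zU : ℚ) * zW' - zU' * zW) = (corrV n : ℚ) * q := by
    rw [← hDq]; exact_mod_cast (by rw [← hq]; ring : D ^ 5 * (zU * zW' - zU' * zW) = (corrV n : ℤ) * q)
  calc MV n * recordQ n = M0 n * recordQ n / corrV n := by unfold MV; ring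
    _ = s * (dRec n ^ 5 * ((zU : ℚ) * zW' - zU' * zW)) / corrV n := by rw [key]; ring
    _ = ((s * q : ℤ) : ℚ) := by rw [e]; push_cast; field_simp

/-- **Size**: for every `ε > 0`, eventually `MV n ≤ e^{(115.1463 + ε)·n}` (`381.5232 − 266.3769`). -/
theorem eventually_MV_le_exp {ε : ℝ} (hε : 0 < ε) :
    ∀ᶠ n : ℕ in atTop, ((MV n : ℚ) : ℝ) ≤ Real.exp (((3815232 / 10000 - 21192947 / 79560 : ℚ) + ε) * n) := by
  have hε2 : 0 < ε / 2 := by positivity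
  have hΦ := eventually_exp_le_multiWindowProd (s := (Finset.univ : Finset (Fin 33))) (w := wQv) AwinV_le_BwinV hε2
  filter_upwards [eventually_M0_le_exp hε2, hΦ] with n hM0 hcorr
  rw [window_rateV] at hcorr
  have hcorr' : Real.exp ((21192947 / 79560 - ε / 2) * n) ≤ ((corrV n : ℕ) : ℝ) := hcorr
  have hcpos : (0 : ℝ) < ((corrV n : ℕ) : ℝ) := by exact_mod_cast corrV_pos n
  have hcast : ((MV n : ℚ) : ℝ) = ((M0 n : ℚ) : ℝ) / ((corrV n : ℕ) : ℝ) := by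
    unfold MV; push_cast; rfl
  rw [hcast]
  calc ((M0 n : ℚ) : ℝ) / ((corrV n : ℕ) : ℝ) ≤ Real.exp ((3815232 / 10000 + ε / 2) * n) / ((corrV n : ℕ) : ℝ) :=
        div_le_div_of_nonneg_right hM0 hcpos.le
    _ ≤ Real.exp ((3815232 / 10000 + ε / 2) * n) / Real.exp ((21192947 / 79560 - ε / 2) * n) :=
        div_le_div_of_nonneg_left (Real.exp_pos _).le (Real.exp_pos _) hcorr'
    _ = Real.exp (((3815232 / 10000 - 21192947 / 79560 : ℚ) + ε) * n) := by rw [← Real.exp_sub]; push_cast; ring_nf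

/-- **THE EXPONENT `0.5823`, hypothesis-free.**  For every `0 ≤ γ ≤ 0.5823`, eventually
`|ζ(5) − P_n/Q(a·n)| < 1/q_n^γ` with the integers `p_n = MV n·P_n`, `q_n = MV n·|Q(a·n)| ≥ 1`.
Arithmetic: `0.5823·(115.1463 + 0.02 + 85.08768884) < 85.08768883 + 31.5452`.  No irrationality content (`γ < 1`). -/
theorem record_exponent_atlas33 {γ : ℝ} (hγ0 : 0 ≤ γ) (hγ : γ ≤ 5823 / 10000) :
    ∀ᶠ n : ℕ in atTop, ∃ p : ℤ, ∃ q : ℕ, 1 ≤ q ∧ (q : ℚ) = MV n * |(recordQ n : ℚ)| ∧ (p : ℚ) = MV n * recordP n ∧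
      |zetaValue 5 - (recordP n : ℝ) / (recordQ n : ℝ)| < 1 / (q : ℝ) ^ γ := by
  refine record_exponent_rat (lam := ((3815232 / 10000 - 21192947 / 79560 : ℚ) : ℝ) + 2 / 100) MV ?_ hγ0 (by push_cast; nlinarith)
  filter_upwards [eventually_MV_le_exp (show (0 : ℝ) < 2 / 100 by norm_num), eventually_ge_atTop 47] with n hn hnN
  exact ⟨MV_pos n, MV_mul_recordP_int hnN, MV_mul_recordQ_int hnN, hn⟩

end Summit.KontsevichZagierPeriods.Zeta5Search.RecordRay
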